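import Summits.QuantumFields.YangMills.Theorems.AllWindowsColdBoxBoxHighLineWilsonPlaquetteQuarticFormCore
import Summits.QuantumFields.YangMills.Theorems.AllWindowsColdBoxBoxHighLineTripleFormExpansion
import Summits.QuantumFields.YangMills.Theorems.AllWindowsColdBoxBoxHighLineTiltSupBoundsWilson

/-!
# T-S5.7a⁽⁴⁾ `WilsonPlaquetteQuarticForm` BY NAME: the Wilson plaquette cost in the edge chart is `‖ℓ_p‖² + c_p^{odd} + Q⁴_p + O(s⁶)` with `Q⁴_p` an explicit
# QUARTIC PAIR FORM, and `Q⁴_p` as a finite sum of COORDINATE MONOMIALS for the Wick engine (ASSEMBLY-U5 §8 blocker «7a⁽⁴⁾», K3′ exact row E1)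

Width seat `ym-line-sfw-p2-w3` (g42), cell ym-idea-1 (planner ym-idea-2 g18 RULING 2026-08-30T01:12:48Z, E1 chain (α)).  Over the scalar sixth-order estimate
✓`WilsonTaylor.even6` (`…WilsonPlaquetteQuarticFormCore`):

* `WilsonTaylor.norm_plaqLin_sq_eq`, `abs_dot_le_sq`, ★`abs_even_remainder6_le` — four chart points `‖v_i‖ ≤ t ≤ 1`:
  `|cost(v) − (cost(v) − cost(−v))/2 − ‖v₀+v₁−v₂−v₃‖² − Q⁴(v)| ≤ 20t⁶` with `Q⁴(v)` written out in `‖v_i‖²`, `v_k·v_l`;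
* `WilsonTaylor.quarticTensor_sum_eq` — `Q⁴(v) = Σ_{ijkl} Q_{ijkl}·(v_i·v_j)(v_k·v_l)` for the explicit pair tensor `Q` (`|Q_{ijkl}| ≤ 1/2`; diagonal entries `−1/12`,
  `−1/4`, pair–diagonal `±1/2`, `±1/6`, pair–pair `±1/4`);
* ★★ `WilsonTaylor.chartPlaqCost_quarticForm` — `∃ Q, (∀ ijkl, |Q_{ijkl}| ≤ 1/2) ∧ ∀ H x μ ν t a, 0 ≤ t ≤ 1, ‖plaqVar_i‖ ≤ t:`
  `|chartPlaqCost H x μ ν a − linCurvSq H (x,μ,ν) a − chartPlaqCostOdd H x μ ν a − Σ_{ijkl} Q_{ijkl}(v_i·v_j)(v_k·v_l)| ≤ 20·t⁶`, `v = plaqVar H x μ ν a`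
  (✓`WilsonSandwich.chartPlaqCost_eq`, ✓`WilsonSandwich.linCurvSq_eq_norm_sq`, oddness of the chart ✓`WilsonTaylor.plaqVar_neg`);
* ★ `EdgeChartGaussian.quarticPairSum_plaqVar_expansion` — for `|Q| ≤ B`: `Σ_{ijkl} Q_{ijkl}(v_i·v_j)(v_k·v_l) = Σ_k cA_k·∏_{s<4} a_{leg k s}` over a finite index type with
  `Σ|cA_k| ≤ 2304·B` and every leg of a non-zero monomial on an edge of the plaquette (hence within sup-distance `1` of `x`, ✓`plaqEdge_fst_sub_le`) — the input
  shape of ✓`WickPairCubic.abs_gaussAvg_centredLandauForms_mul_four_connected_le` (pattern of ✓`tripleForm_plaqVar_expansion`; no colour condition is needed at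
  order four);
* ★★ `WilsonTaylor.exists_quarticTensor_quarticWilson` — the QUARTIC TENSOR OF RECORD: one `Q` (`|Q| ≤ 1/2`) with the clause above AND, on `smallField H s`
  (`0 ≤ s ≤ 1`, `H ≥ 1`), `|quarticWilson β H a − β·Σ_{p touching} Σ_{ijkl} Q_{ijkl}(v^p_i·v^p_j)(v^p_k·v^p_l)| ≤ 81920·|β|·H⁴·s⁶` — the polynomial part is the `U`-slot of
  the exact row E1 (generic `∀ B Q` there), the sextic remainder is the sup×L² row (K7) `12θ + 6κ₃ < 2` of the K3′ split.

Tree + Mathlib only; no definitions (the tensor is an explicit lambda, packaged existentially); standard axioms.  HONEST LABEL: a Taylor/bookkeeping brick for the K3′ exact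
row E1 of the UNSTAFFED stub U5 (⟨stmt-QuantumFields-24336⟩); ⟨24004⟩ ⟨24336⟩ and this seat's crux ⟨stmt-QuantumFields-22884⟩ remain OPEN; route AllWindowsColdBox is DRAFT;
no crux, rung or summit is proved; **the Yang–Mills mass gap is NOT proved by this file; no summit is proved by a line.**
-/

set_option autoImplicit false

noncomputable section

open Matrix Finset
open Literature.Probability.LatticeModels (Site)
open Literature.MathematicalPhysics.QuantumFieldTheory.Balaban1983to89.B10Eq18SigmaSU2Haar (expPauli)

namespace Summit.QuantumFields.YangMills.Theorems.AllWindowsColdBoxBoxHighLine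

namespace WilsonTaylor

/-! ## §1 Four chart points -/

/-- `‖v₀+v₁−v₂−v₃‖²` in pairings. -/
theorem norm_plaqLin_sq_eq (v : Fin 4 → E3) :
    ‖plaqLin v‖ ^ 2 = ‖v 0‖ ^ 2 + ‖v 1‖ ^ 2 + ‖v 2‖ ^ 2 + ‖v 3‖ ^ 2
      + 2 * (WithLp.ofLp (v 0) ⬝ᵥ WithLp.ofLp (v 1)) + 2 * (WithLp.ofLp (v 2) ⬝ᵥ WithLp.ofLp (v 3))
      - 2 * (WithLp.ofLp (v 0) ⬝ᵥ WithLp.ofLp (v 2)) - 2 * (WithLp.ofLp (v 0) ⬝ᵥ WithLp.ofLp (v 3))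
      - 2 * (WithLp.ofLp (v 1) ⬝ᵥ WithLp.ofLp (v 2)) - 2 * (WithLp.ofLp (v 1) ⬝ᵥ WithLp.ofLp (v 3)) := by
  rw [← SmallFieldPlaq.dotProduct_self_eq_norm_sq, ← SmallFieldPlaq.dotProduct_self_eq_norm_sq, ← SmallFieldPlaq.dotProduct_self_eq_norm_sq,
    ← SmallFieldPlaq.dotProduct_self_eq_norm_sq, ← SmallFieldPlaq.dotProduct_self_eq_norm_sq]
  unfold plaqLin
  simp only [WithLp.ofLp_add, WithLp.ofLp_sub, add_dotProduct, sub_dotProduct, dotProduct_add, dotProduct_sub,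
    dotProduct_comm (WithLp.ofLp (v 1)) (WithLp.ofLp (v 0)), dotProduct_comm (WithLp.ofLp (v 2)) (WithLp.ofLp (v 0)),
    dotProduct_comm (WithLp.ofLp (v 3)) (WithLp.ofLp (v 0)), dotProduct_comm (WithLp.ofLp (v 2)) (WithLp.ofLp (v 1)),
    dotProduct_comm (WithLp.ofLp (v 3)) (WithLp.ofLp (v 1)), dotProduct_comm (WithLp.ofLp (v 3)) (WithLp.ofLp (v 2))]
  ring

/-- `|v_k·v_l| ≤ t²` for `‖v_k‖, ‖v_l‖ ≤ t`. -/
theorem abs_dot_le_sq (v : Fin 4 → E3) {t : ℝ} (ht0 : 0 ≤ t) (hv : ∀ i, ‖v i‖ ≤ t) (k l : Fin 4) :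
    |WithLp.ofLp (v k) ⬝ᵥ WithLp.ofLp (v l)| ≤ t ^ 2 := by
  have h := PlaqCost.abs_dotProduct_le_of (WithLp.ofLp (v k)) (WithLp.ofLp (v l))
    ((WilsonSandwich.sqrt_dot_self (v k)).le.trans (hv k)) ((WilsonSandwich.sqrt_dot_self (v l)).le.trans (hv l)) ht0
  rw [sq]; exact h

/-- ★★ **Clause 1 to sixth order for four chart points**: `|cost(v) − (cost(v) − cost(−v))/2 − ‖plaqLin v‖² − Q⁴(v)| ≤ 20t⁶`, with the quartic form `Q⁴(v)`
written out in `‖v_i‖²` and the pairings `v_k·v_l`. -/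
theorem abs_even_remainder6_le (v : Fin 4 → E3) {t : ℝ} (ht0 : 0 ≤ t) (ht1 : t ≤ 1) (hv : ∀ i, ‖v i‖ ≤ t) :
    |(2 - (((expPauli (v 0) * expPauli (v 1) * (expPauli (v 2))⁻¹ * (expPauli (v 3))⁻¹ : SU2) : Matrix (Fin 2) (Fin 2) ℂ)).trace.re)
      - ((2 - (((expPauli (v 0) * expPauli (v 1) * (expPauli (v 2))⁻¹ * (expPauli (v 3))⁻¹ : SU2) : Matrix (Fin 2) (Fin 2) ℂ)).trace.re)
          - (2 - (((expPauli (-v 0) * expPauli (-v 1) * (expPauli (-v 2))⁻¹ * (expPauli (-v 3))⁻¹ : SU2) :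
              Matrix (Fin 2) (Fin 2) ℂ)).trace.re)) / 2
      - ‖plaqLin v‖ ^ 2
      - (-(‖v 0‖ ^ 2 ^ 2 + ‖v 1‖ ^ 2 ^ 2 + ‖v 2‖ ^ 2 ^ 2 + ‖v 3‖ ^ 2 ^ 2) / 12
          - (‖v 0‖ ^ 2 * ‖v 1‖ ^ 2 + ‖v 0‖ ^ 2 * ‖v 2‖ ^ 2 + ‖v 0‖ ^ 2 * ‖v 3‖ ^ 2 + ‖v 1‖ ^ 2 * ‖v 2‖ ^ 2 + ‖v 1‖ ^ 2 * ‖v 3‖ ^ 2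
              + ‖v 2‖ ^ 2 * ‖v 3‖ ^ 2) / 2
          - 2 * (WithLp.ofLp (v 0) ⬝ᵥ WithLp.ofLp (v 1)) * ((‖v 2‖ ^ 2 + ‖v 3‖ ^ 2) / 2 + (‖v 0‖ ^ 2 + ‖v 1‖ ^ 2) / 6)
          - 2 * (WithLp.ofLp (v 2) ⬝ᵥ WithLp.ofLp (v 3)) * ((‖v 0‖ ^ 2 + ‖v 1‖ ^ 2) / 2 + (‖v 2‖ ^ 2 + ‖v 3‖ ^ 2) / 6)
          + 2 * (WithLp.ofLp (v 0) ⬝ᵥ WithLp.ofLp (v 2)) * ((‖v 1‖ ^ 2 + ‖v 3‖ ^ 2) / 2 + (‖v 0‖ ^ 2 + ‖v 2‖ ^ 2) / 6)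
          + 2 * (WithLp.ofLp (v 0) ⬝ᵥ WithLp.ofLp (v 3)) * ((‖v 1‖ ^ 2 + ‖v 2‖ ^ 2) / 2 + (‖v 0‖ ^ 2 + ‖v 3‖ ^ 2) / 6)
          + 2 * (WithLp.ofLp (v 1) ⬝ᵥ WithLp.ofLp (v 2)) * ((‖v 0‖ ^ 2 + ‖v 3‖ ^ 2) / 2 + (‖v 1‖ ^ 2 + ‖v 2‖ ^ 2) / 6)
          + 2 * (WithLp.ofLp (v 1) ⬝ᵥ WithLp.ofLp (v 3)) * ((‖v 0‖ ^ 2 + ‖v 2‖ ^ 2) / 2 + (‖v 1‖ ^ 2 + ‖v 3‖ ^ 2) / 6)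
          - 2 * ((WithLp.ofLp (v 0) ⬝ᵥ WithLp.ofLp (v 1)) * (WithLp.ofLp (v 2) ⬝ᵥ WithLp.ofLp (v 3))
              - (WithLp.ofLp (v 0) ⬝ᵥ WithLp.ofLp (v 2)) * (WithLp.ofLp (v 1) ⬝ᵥ WithLp.ofLp (v 3))
              + (WithLp.ofLp (v 0) ⬝ᵥ WithLp.ofLp (v 3)) * (WithLp.ofLp (v 1) ⬝ᵥ WithLp.ofLp (v 2))))| ≤ 20 * t ^ 6 := by
  rw [re_trace_eq, re_trace_neg_eq, norm_plaqLin_sq_eq]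
  simp only [smul_dotProduct, dotProduct_smul, smul_eq_mul]
  have hr0 : ∀ i, 0 ≤ ‖v i‖ := fun i => norm_nonneg _
  have hx : ∀ i, ‖v i‖ ^ 2 ≤ t ^ 2 := fun i => pow_le_pow_left₀ (hr0 i) (hv i) 2
  have hc : ∀ i, 1 - ‖v i‖ ^ 2 / 2 ≤ Real.cos ‖v i‖ := fun i => Real.one_sub_sq_div_two_le_cos
  have key := even6 ht0 ht1 (sq_nonneg ‖v 0‖) (sq_nonneg ‖v 1‖) (sq_nonneg ‖v 2‖) (sq_nonneg ‖v 3‖) (hx 0) (hx 1) (hx 2) (hx 3)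
    (hc 0) (hc 1) (hc 2) (hc 3) (Real.cos_le_one _) (Real.cos_le_one _) (Real.cos_le_one _) (Real.cos_le_one _)
    (cos_hyp (hr0 0) (hv 0) ht1) (cos_hyp (hr0 1) (hv 1) ht1) (cos_hyp (hr0 2) (hv 2) ht1) (cos_hyp (hr0 3) (hv 3) ht1)
    (sinc_hyp (hr0 0) (hv 0) ht1) (sinc_hyp (hr0 1) (hv 1) ht1) (sinc_hyp (hr0 2) (hv 2) ht1) (sinc_hyp (hr0 3) (hv 3) ht1)
    (Real.abs_sinc_le_one _) (Real.abs_sinc_le_one _) (Real.abs_sinc_le_one _)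
    (abs_dot_le_sq v ht0 hv 0 1) (abs_dot_le_sq v ht0 hv 0 2) (abs_dot_le_sq v ht0 hv 0 3) (abs_dot_le_sq v ht0 hv 1 2)
    (abs_dot_le_sq v ht0 hv 1 3) (abs_dot_le_sq v ht0 hv 2 3)
  refine le_trans (le_of_eq ?_) key
  congr 1
  ring

/-! ## §2 The pair tensor -/

/-- ★ The quartic form as a tensor sum: `Σ_{ijkl} Q_{ijkl}(p_i·p_j)(p_k·p_l) = Q⁴(p)` for the explicit pair tensor `Q`. -/
theorem quarticTensor_sum_eq (p : Fin 4 → Fin 3 → ℝ) :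
    ∑ i : Fin 4, ∑ j : Fin 4, ∑ k : Fin 4, ∑ l : Fin 4,
      (fun i j k l : Fin 4 =>
        if i = j ∧ k = l then (if i = k then (-1 / 12 : ℝ) else -1 / 4)
        else if k = l then
          (if (i = 0 ∧ j = 1) ∨ (i = 1 ∧ j = 0) ∨ (i = 2 ∧ j = 3) ∨ (i = 3 ∧ j = 2) then (-1 : ℝ) else 1) * (if k = i ∨ k = j then 1 / 6 else 1 / 2)
        else if i ≠ k ∧ i ≠ l ∧ j ≠ k ∧ j ≠ l ∧ i ≠ j then
          (if (i = 0 ∧ j = 2) ∨ (i = 2 ∧ j = 0) ∨ (i = 1 ∧ j = 3) ∨ (i = 3 ∧ j = 1) then (1 / 4 : ℝ) else -1 / 4)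
        else 0) i j k l * ((p i ⬝ᵥ p j) * (p k ⬝ᵥ p l)) =
      -((p 0 ⬝ᵥ p 0) ^ 2 + (p 1 ⬝ᵥ p 1) ^ 2 + (p 2 ⬝ᵥ p 2) ^ 2 + (p 3 ⬝ᵥ p 3) ^ 2) / 12
      - ((p 0 ⬝ᵥ p 0) * (p 1 ⬝ᵥ p 1) + (p 0 ⬝ᵥ p 0) * (p 2 ⬝ᵥ p 2) + (p 0 ⬝ᵥ p 0) * (p 3 ⬝ᵥ p 3) + (p 1 ⬝ᵥ p 1) * (p 2 ⬝ᵥ p 2)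
          + (p 1 ⬝ᵥ p 1) * (p 3 ⬝ᵥ p 3) + (p 2 ⬝ᵥ p 2) * (p 3 ⬝ᵥ p 3)) / 2
      - 2 * (p 0 ⬝ᵥ p 1) * (((p 2 ⬝ᵥ p 2) + (p 3 ⬝ᵥ p 3)) / 2 + ((p 0 ⬝ᵥ p 0) + (p 1 ⬝ᵥ p 1)) / 6)
      - 2 * (p 2 ⬝ᵥ p 3) * (((p 0 ⬝ᵥ p 0) + (p 1 ⬝ᵥ p 1)) / 2 + ((p 2 ⬝ᵥ p 2) + (p 3 ⬝ᵥ p 3)) / 6)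
      + 2 * (p 0 ⬝ᵥ p 2) * (((p 1 ⬝ᵥ p 1) + (p 3 ⬝ᵥ p 3)) / 2 + ((p 0 ⬝ᵥ p 0) + (p 2 ⬝ᵥ p 2)) / 6)
      + 2 * (p 0 ⬝ᵥ p 3) * (((p 1 ⬝ᵥ p 1) + (p 2 ⬝ᵥ p 2)) / 2 + ((p 0 ⬝ᵥ p 0) + (p 3 ⬝ᵥ p 3)) / 6)
      + 2 * (p 1 ⬝ᵥ p 2) * (((p 0 ⬝ᵥ p 0) + (p 3 ⬝ᵥ p 3)) / 2 + ((p 1 ⬝ᵥ p 1) + (p 2 ⬝ᵥ p 2)) / 6)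
      + 2 * (p 1 ⬝ᵥ p 3) * (((p 0 ⬝ᵥ p 0) + (p 2 ⬝ᵥ p 2)) / 2 + ((p 1 ⬝ᵥ p 1) + (p 3 ⬝ᵥ p 3)) / 6)
      - 2 * ((p 0 ⬝ᵥ p 1) * (p 2 ⬝ᵥ p 3) - (p 0 ⬝ᵥ p 2) * (p 1 ⬝ᵥ p 3) + (p 0 ⬝ᵥ p 3) * (p 1 ⬝ᵥ p 2)) := by
  simp only [Fin.sum_univ_four, Fin.isValue]
  simp only [Fin.reduceEq, and_true, and_false, or_false, or_true, if_true, if_false, ne_eq, not_true, not_false_eq_true, and_self]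
  simp only [dotProduct_comm (p 1) (p 0), dotProduct_comm (p 2) (p 0), dotProduct_comm (p 3) (p 0), dotProduct_comm (p 2) (p 1),
    dotProduct_comm (p 3) (p 1), dotProduct_comm (p 3) (p 2)]
  ring

/-- ★★ **T-S5.7a⁽⁴⁾ `WilsonPlaquetteQuarticForm`, BY NAME.**  There is a pair tensor `Q` with `|Q_{ijkl}| ≤ 1/2` such that for every plaquette `(x,μ,ν)` and every field
whose four plaquette variables `v = plaqVar H x μ ν a` have norms `≤ t ≤ 1`:
`|chartPlaqCost H x μ ν a − linCurvSq H (x,μ,ν) a − chartPlaqCostOdd H x μ ν a − Σ_{ijkl} Q_{ijkl}(v_i·v_j)(v_k·v_l)| ≤ 20·t⁶`. -/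
theorem chartPlaqCost_quarticForm : ∃ Q : Fin 4 → Fin 4 → Fin 4 → Fin 4 → ℝ, (∀ i j k l, |Q i j k l| ≤ 1 / 2) ∧
    ∀ (H : ℕ) (x : Site 4) (μ ν : Fin 4) (t : ℝ) (a : LandauFree H → E3), 0 ≤ t → t ≤ 1 → (∀ i, ‖plaqVar H x μ ν a i‖ ≤ t) →
      |chartPlaqCost H x μ ν a - linCurvSq H (x, μ, ν) a - chartPlaqCostOdd H x μ ν a -
        ∑ i : Fin 4, ∑ j : Fin 4, ∑ k : Fin 4, ∑ l : Fin 4, Q i j k l *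
          ((WithLp.ofLp (plaqVar H x μ ν a i) ⬝ᵥ WithLp.ofLp (plaqVar H x μ ν a j)) *
            (WithLp.ofLp (plaqVar H x μ ν a k) ⬝ᵥ WithLp.ofLp (plaqVar H x μ ν a l)))| ≤ 20 * t ^ 6 := by
  refine ⟨(fun i j k l : Fin 4 =>
        if i = j ∧ k = l then (if i = k then (-1 / 12 : ℝ) else -1 / 4)
        else if k = l then
          (if (i = 0 ∧ j = 1) ∨ (i = 1 ∧ j = 0) ∨ (i = 2 ∧ j = 3) ∨ (i = 3 ∧ j = 2) then (-1 : ℝ) else 1) * (if k = i ∨ k = j then 1 / 6 else 1 / 2)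
        else if i ≠ k ∧ i ≠ l ∧ j ≠ k ∧ j ≠ l ∧ i ≠ j then
          (if (i = 0 ∧ j = 2) ∨ (i = 2 ∧ j = 0) ∨ (i = 1 ∧ j = 3) ∨ (i = 3 ∧ j = 1) then (1 / 4 : ℝ) else -1 / 4)
        else 0), fun i j k l => ?_, fun H x μ ν t a ht0 ht1 hv => ?_⟩
  · dsimp only
    split_ifs <;> norm_num
  rw [quarticTensor_sum_eq (fun i => WithLp.ofLp (plaqVar H x μ ν a i)), WilsonSandwich.linCurvSq_eq_norm_sq]
  have hodd : chartPlaqCostOdd H x μ ν a =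
      ((2 - (((expPauli (plaqVar H x μ ν a 0) * expPauli (plaqVar H x μ ν a 1) * (expPauli (plaqVar H x μ ν a 2))⁻¹ *
          (expPauli (plaqVar H x μ ν a 3))⁻¹ : SU2) : Matrix (Fin 2) (Fin 2) ℂ)).trace.re)
        - (2 - (((expPauli (-plaqVar H x μ ν a 0) * expPauli (-plaqVar H x μ ν a 1) * (expPauli (-plaqVar H x μ ν a 2))⁻¹ *
          (expPauli (-plaqVar H x μ ν a 3))⁻¹ : SU2) : Matrix (Fin 2) (Fin 2) ℂ)).trace.re)) / 2 := by
    rw [chartPlaqCostOdd, WilsonSandwich.chartPlaqCost_eq, WilsonSandwich.chartPlaqCost_eq]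
    simp only [plaqVar_neg]
  rw [hodd, WilsonSandwich.chartPlaqCost_eq]
  have h := abs_even_remainder6_le (plaqVar H x μ ν a) ht0 ht1 hv
  simp only [SmallFieldPlaq.dotProduct_self_eq_norm_sq] at h ⊢
  refine le_trans (le_of_eq ?_) h
  congr 1
  ring

end WilsonTaylor

/-! ## §3 The quartic pair form as coordinate monomials -/

namespace EdgeChartGaussian

/-- ★ **Monomial expansion of a quartic pair form in the plaquette variables.**  For every plaquette `(x, μ, ν)` and coefficients `|Q_{ijkl}| ≤ B` there are finitely
many monomials `cA_k · a_{leg k 0} a_{leg k 1} a_{leg k 2} a_{leg k 3}` with `Σ|cA_k| ≤ 2304·B` and (when `cA_k ≠ 0`) all legs on edges of the plaquette, summing to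
`Σ_{ijkl} Q_{ijkl}·(v_i·v_j)(v_k·v_l)`, `v = plaqVar H x μ ν a`, for every field `a`. -/
theorem quarticPairSum_plaqVar_expansion (H : ℕ) (x : Site 4) (μ ν : Fin 4) (Q : Fin 4 → Fin 4 → Fin 4 → Fin 4 → ℝ) {B : ℝ}
    (hQ : ∀ i j k l, |Q i j k l| ≤ B) :
    ∃ (K : Type) (_ : Fintype K) (cA : K → ℝ) (leg : K → Fin 4 → LandauFree H × Fin 3),
      (∑ k, |cA k| ≤ 2304 * B) ∧
      (∀ k, cA k ≠ 0 → ∀ s, ∃ i : Fin 4,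
        ((leg k s).1.1.1 : Literature.MathematicalPhysics.QuantumLattice.ZdEdge 4) = plaqEdge x μ ν i) ∧
      ∀ a : LandauFree H → E3,
        ∑ i : Fin 4, ∑ j : Fin 4, ∑ k : Fin 4, ∑ l : Fin 4, Q i j k l *
          ((WithLp.ofLp (plaqVar H x μ ν a i) ⬝ᵥ WithLp.ofLp (plaqVar H x μ ν a j)) *
            (WithLp.ofLp (plaqVar H x μ ν a k) ⬝ᵥ WithLp.ofLp (plaqVar H x μ ν a l))) =
        ∑ k, cA k * ∏ s : Fin 4, a (leg k s).1 (leg k s).2 := by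
  classical
  let K : Type := ((Fin 4 × Fin 4 × Fin 4 × Fin 4) × (Fin 3 × Fin 3)) × (LandauFree H × LandauFree H × LandauFree H × LandauFree H)
  let δ : LandauFree H → Fin 4 → ℝ := fun e i =>
    if (e.1.1 : Literature.MathematicalPhysics.QuantumLattice.ZdEdge 4) = plaqEdge x μ ν i then 1 else 0
  let cA : K → ℝ := fun k => Q k.1.1.1 k.1.1.2.1 k.1.1.2.2.1 k.1.1.2.2.2 *
    (δ k.2.1 k.1.1.1 * δ k.2.2.1 k.1.1.2.1 * δ k.2.2.2.1 k.1.1.2.2.1 * δ k.2.2.2.2 k.1.1.2.2.2)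
  let leg : K → Fin 4 → LandauFree H × Fin 3 := fun k s =>
    (![k.2.1, k.2.2.1, k.2.2.2.1, k.2.2.2.2] s, ![k.1.2.1, k.1.2.1, k.1.2.2, k.1.2.2] s)
  have hδnn : ∀ e i, 0 ≤ δ e i := fun e i => by
    simp only [δ]; split_ifs <;> norm_num
  have hδ1 : ∀ e i, δ e i ≤ 1 := fun e i => by
    simp only [δ]; split_ifs <;> norm_num
  -- at most one free edge sits on a given lattice edge
  have hδsum : ∀ i, ∑ e : LandauFree H, δ e i ≤ 1 := by
    intro i
    simp only [δ]
    rw [Finset.sum_boole]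
    have hcard : (Finset.univ.filter fun e : LandauFree H =>
        (e.1.1 : Literature.MathematicalPhysics.QuantumLattice.ZdEdge 4) = plaqEdge x μ ν i).card ≤ 1 := by
      refine Finset.card_le_one.2 fun e he e' he' => ?_
      rw [Finset.mem_filter] at he he'
      exact landauFree_ext (he.2.trans he'.2.symm)
    exact_mod_cast hcard
  have hB : 0 ≤ B := (abs_nonneg _).trans (hQ 0 0 0 0)
  refine ⟨K, inferInstance, cA, leg, ?_, ?_, ?_⟩
  · -- Σ |cA| ≤ Σ_{ijkl,κκ'} B · (Σ_e δ)⁴ ≤ 2304·B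
    have hterm : ∀ k : K, |cA k| ≤ B * (δ k.2.1 k.1.1.1 * δ k.2.2.1 k.1.1.2.1 * δ k.2.2.2.1 k.1.1.2.2.1 * δ k.2.2.2.2 k.1.1.2.2.2) := by
      intro k
      have hnn : 0 ≤ δ k.2.1 k.1.1.1 * δ k.2.2.1 k.1.1.2.1 * δ k.2.2.2.1 k.1.1.2.2.1 * δ k.2.2.2.2 k.1.1.2.2.2 :=
        mul_nonneg (mul_nonneg (mul_nonneg (hδnn _ _) (hδnn _ _)) (hδnn _ _)) (hδnn _ _)
      simp only [cA]
      rw [abs_mul, abs_of_nonneg hnn]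
      exact mul_le_mul_of_nonneg_right (hQ _ _ _ _) hnn
    have hquad : ∀ i j k l : Fin 4,
        ∑ e₁ : LandauFree H, ∑ e₂ : LandauFree H, ∑ e₃ : LandauFree H, ∑ e₄ : LandauFree H, δ e₁ i * δ e₂ j * δ e₃ k * δ e₄ l ≤ 1 := by
      intro i j k l
      have h4 : ∑ e₁ : LandauFree H, ∑ e₂ : LandauFree H, ∑ e₃ : LandauFree H, ∑ e₄ : LandauFree H, δ e₁ i * δ e₂ j * δ e₃ k * δ e₄ l =
          (∑ e₁ : LandauFree H, δ e₁ i) * ((∑ e₂ : LandauFree H, δ e₂ j) * ((∑ e₃ : LandauFree H, δ e₃ k) * ∑ e₄ : LandauFree H, δ e₄ l)) := by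
        simp_rw [Finset.sum_mul, Finset.mul_sum, mul_assoc]
      rw [h4]
      have n2 : 0 ≤ ∑ e : LandauFree H, δ e j := Finset.sum_nonneg fun e _ => hδnn _ _
      have n3 : 0 ≤ ∑ e : LandauFree H, δ e k := Finset.sum_nonneg fun e _ => hδnn _ _
      have n4 : 0 ≤ ∑ e : LandauFree H, δ e l := Finset.sum_nonneg fun e _ => hδnn _ _
      exact mul_le_one₀ (hδsum i) (mul_nonneg n2 (mul_nonneg n3 n4))
        (mul_le_one₀ (hδsum j) (mul_nonneg n3 n4) (mul_le_one₀ (hδsum k) n4 (hδsum l)))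
    calc ∑ k, |cA k| ≤ ∑ k : K, B * (δ k.2.1 k.1.1.1 * δ k.2.2.1 k.1.1.2.1 * δ k.2.2.2.1 k.1.1.2.2.1 * δ k.2.2.2.2 k.1.1.2.2.2) :=
          Finset.sum_le_sum fun k _ => hterm k
      _ = ∑ q : (Fin 4 × Fin 4 × Fin 4 × Fin 4) × (Fin 3 × Fin 3), B * ∑ e₁ : LandauFree H, ∑ e₂ : LandauFree H, ∑ e₃ : LandauFree H,
            ∑ e₄ : LandauFree H, δ e₁ q.1.1 * δ e₂ q.1.2.1 * δ e₃ q.1.2.2.1 * δ e₄ q.1.2.2.2 := by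
          simp only [K, Fintype.sum_prod_type, Finset.mul_sum]
      _ ≤ ∑ _q : (Fin 4 × Fin 4 × Fin 4 × Fin 4) × (Fin 3 × Fin 3), B * 1 :=
          Finset.sum_le_sum fun q _ => mul_le_mul_of_nonneg_left (hquad _ _ _ _) hB
      _ = 2304 * B := by
          rw [Finset.sum_const, Finset.card_univ, nsmul_eq_mul, mul_one]
          simp only [Fintype.card_prod, Fintype.card_fin]
          norm_num
  · -- legs of non-zero monomials sit on plaquette edges
    intro k hk s
    have key : ∀ e i, δ e i ≠ 0 →
        ((e.1.1 : Literature.MathematicalPhysics.QuantumLattice.ZdEdge 4) = plaqEdge x μ ν i) := by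
      intro e i h
      by_contra hc
      exact h (by simp only [δ, if_neg hc])
    have hne : δ k.2.1 k.1.1.1 ≠ 0 ∧ δ k.2.2.1 k.1.1.2.1 ≠ 0 ∧ δ k.2.2.2.1 k.1.1.2.2.1 ≠ 0 ∧ δ k.2.2.2.2 k.1.1.2.2.2 ≠ 0 := by
      refine ⟨fun h => hk ?_, fun h => hk ?_, fun h => hk ?_, fun h => hk ?_⟩ <;> simp only [cA, h, mul_zero, zero_mul]
    fin_cases s
    · exact ⟨k.1.1.1, key _ _ hne.1⟩
    · exact ⟨k.1.1.2.1, key _ _ hne.2.1⟩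
    · exact ⟨k.1.1.2.2.1, key _ _ hne.2.2.1⟩
    · exact ⟨k.1.1.2.2.2, key _ _ hne.2.2.2⟩
  · -- the expansion itself
    intro a
    have hv : ∀ (i : Fin 4) (c : Fin 3), WithLp.ofLp (plaqVar H x μ ν a i) c = ∑ e : LandauFree H, δ e i * a e c := by
      intro i c
      simp only [plaqVar, δ]
      rw [freeVec_apply_eq_sum]
      refine Finset.sum_congr rfl fun e _ => ?_
      split_ifs <;> simp
    have hR : ∑ k : K, cA k * ∏ s : Fin 4, a (leg k s).1 (leg k s).2 =
        ∑ i : Fin 4, ∑ j : Fin 4, ∑ k : Fin 4, ∑ l : Fin 4, ∑ κ : Fin 3, ∑ κ' : Fin 3,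
          ∑ e₁ : LandauFree H, ∑ e₂ : LandauFree H, ∑ e₃ : LandauFree H, ∑ e₄ : LandauFree H,
          Q i j k l * (δ e₁ i * δ e₂ j * δ e₃ k * δ e₄ l) * (a e₁ κ * a e₂ κ * a e₃ κ' * a e₄ κ') := by
      simp only [K, cA, leg, Fintype.sum_prod_type, Fin.prod_univ_four, Matrix.cons_val_zero, Matrix.cons_val_one,
        Matrix.cons_val_two, Matrix.cons_val_three, Matrix.head_cons, Matrix.tail_cons]
    have hdist : ∀ (c : ℝ) (f g h w : LandauFree H → ℝ),
        c * (((∑ e, f e) * ∑ e, g e) * ((∑ e, h e) * ∑ e, w e)) = ∑ e₁, ∑ e₂, ∑ e₃, ∑ e₄, c * (f e₁ * g e₂ * h e₃ * w e₄) := by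
      intro c f g h w
      rw [Finset.sum_mul_sum, Finset.sum_mul_sum, Finset.sum_mul, Finset.mul_sum _ _ c]
      refine Finset.sum_congr rfl fun e₁ _ => ?_
      rw [Finset.sum_mul, Finset.mul_sum _ _ c]
      refine Finset.sum_congr rfl fun e₂ _ => ?_
      rw [Finset.mul_sum _ _ (f e₁ * g e₂), Finset.mul_sum _ _ c]
      refine Finset.sum_congr rfl fun e₃ _ => ?_
      rw [Finset.mul_sum _ _ (f e₁ * g e₂), Finset.mul_sum _ _ c]
      refine Finset.sum_congr rfl fun e₄ _ => ?_
      ring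
    rw [hR]
    refine Finset.sum_congr rfl fun i _ => Finset.sum_congr rfl fun j _ => Finset.sum_congr rfl fun k _ =>
      Finset.sum_congr rfl fun l _ => ?_
    simp only [dotProduct, hv]
    rw [Finset.sum_mul_sum, Finset.mul_sum]
    refine Finset.sum_congr rfl fun κ _ => ?_
    rw [Finset.mul_sum]
    refine Finset.sum_congr rfl fun κ' _ => ?_
    refine Eq.trans (hdist (Q i j k l) (fun e => δ e i * a e κ) (fun e => δ e j * a e κ) (fun e => δ e k * a e κ') (fun e => δ e l * a e κ')) ?_
    refine Finset.sum_congr rfl fun e₁ _ => Finset.sum_congr rfl fun e₂ _ => Finset.sum_congr rfl fun e₃ _ =>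
      Finset.sum_congr rfl fun e₄ _ => ?_
    ring

end EdgeChartGaussian

/-! ## §4 The quartic Wilson vertex: polynomial part of record and the sextic remainder on the small-field set -/

namespace WilsonTaylor

open Literature.MathematicalPhysics.QuantumLattice (plaquettesTouching)
open Literature.MathematicalPhysics.QuantumFieldTheory.AxialGauge (boxEdges)

/-- ★★ **The quartic tensor of record for `quarticWilson`.**  One pair tensor `Q` (`|Q_{ijkl}| ≤ 1/2`, independent of `H`, `β`) such that on `smallField H s`,
`0 ≤ s ≤ 1`, `H ≥ 1`: `|quarticWilson β H a − β·Σ_{p touching} Σ_{ijkl} Q_{ijkl}(v^p_i·v^p_j)(v^p_k·v^p_l)| ≤ 81920·|β|·H⁴·s⁶` (`v^p = plaqVar_p a`; per plaquette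
`chartPlaqCost_quarticForm` with `t = s`, ✓`TiltSup.norm_plaqVar_le`, ✓`TiltSup.card_plaquettesTouching_le'`).  This is the EVEN sextic remainder row (K7) input of the
K3′ split; the polynomial part is the `U`-slot of the exact row E1. -/
theorem exists_quarticTensor_quarticWilson : ∃ Q : Fin 4 → Fin 4 → Fin 4 → Fin 4 → ℝ, (∀ i j k l, |Q i j k l| ≤ 1 / 2) ∧
    (∀ (H : ℕ) (x : Site 4) (μ ν : Fin 4) (t : ℝ) (a : LandauFree H → E3), 0 ≤ t → t ≤ 1 → (∀ i, ‖plaqVar H x μ ν a i‖ ≤ t) →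
      |chartPlaqCost H x μ ν a - linCurvSq H (x, μ, ν) a - chartPlaqCostOdd H x μ ν a -
        ∑ i : Fin 4, ∑ j : Fin 4, ∑ k : Fin 4, ∑ l : Fin 4, Q i j k l *
          ((WithLp.ofLp (plaqVar H x μ ν a i) ⬝ᵥ WithLp.ofLp (plaqVar H x μ ν a j)) *
            (WithLp.ofLp (plaqVar H x μ ν a k) ⬝ᵥ WithLp.ofLp (plaqVar H x μ ν a l)))| ≤ 20 * t ^ 6) ∧
    ∀ (H : ℕ), 1 ≤ H → ∀ (β s : ℝ), 0 ≤ s → s ≤ 1 → ∀ a ∈ smallField H s,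
      |quarticWilson β H a - β * ∑ p ∈ plaquettesTouching (boxEdges 4 (2 * H + 1)),
          ∑ i : Fin 4, ∑ j : Fin 4, ∑ k : Fin 4, ∑ l : Fin 4, Q i j k l *
            ((WithLp.ofLp (plaqVar H p.1 p.2.1.1 p.2.1.2 a i) ⬝ᵥ WithLp.ofLp (plaqVar H p.1 p.2.1.1 p.2.1.2 a j)) *
              (WithLp.ofLp (plaqVar H p.1 p.2.1.1 p.2.1.2 a k) ⬝ᵥ WithLp.ofLp (plaqVar H p.1 p.2.1.1 p.2.1.2 a l)))| ≤
        81920 * |β| * (H : ℝ) ^ 4 * s ^ 6 := by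
  obtain ⟨Q, hQ, h⟩ := chartPlaqCost_quarticForm
  refine ⟨Q, hQ, h, fun H hH β s hs0 hs1 a ha => ?_⟩
  set PT := plaquettesTouching (boxEdges 4 (2 * H + 1)) with hPT
  have hterm : ∀ p ∈ PT, |chartPlaqCost H p.1 p.2.1.1 p.2.1.2 a - linCurvSq H (p.1, p.2.1.1, p.2.1.2) a - chartPlaqCostOdd H p.1 p.2.1.1 p.2.1.2 a -
      ∑ i : Fin 4, ∑ j : Fin 4, ∑ k : Fin 4, ∑ l : Fin 4, Q i j k l *
        ((WithLp.ofLp (plaqVar H p.1 p.2.1.1 p.2.1.2 a i) ⬝ᵥ WithLp.ofLp (plaqVar H p.1 p.2.1.1 p.2.1.2 a j)) *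
          (WithLp.ofLp (plaqVar H p.1 p.2.1.1 p.2.1.2 a k) ⬝ᵥ WithLp.ofLp (plaqVar H p.1 p.2.1.1 p.2.1.2 a l)))| ≤ 20 * s ^ 6 :=
    fun p _ => h H p.1 p.2.1.1 p.2.1.2 s a hs0 hs1 (TiltSup.norm_plaqVar_le hs0 ha p.1 p.2.1.1 p.2.1.2)
  have hdiff : quarticWilson β H a - β * ∑ p ∈ PT, ∑ i : Fin 4, ∑ j : Fin 4, ∑ k : Fin 4, ∑ l : Fin 4, Q i j k l *
      ((WithLp.ofLp (plaqVar H p.1 p.2.1.1 p.2.1.2 a i) ⬝ᵥ WithLp.ofLp (plaqVar H p.1 p.2.1.1 p.2.1.2 a j)) *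
        (WithLp.ofLp (plaqVar H p.1 p.2.1.1 p.2.1.2 a k) ⬝ᵥ WithLp.ofLp (plaqVar H p.1 p.2.1.1 p.2.1.2 a l))) =
      β * ∑ p ∈ PT, (chartPlaqCost H p.1 p.2.1.1 p.2.1.2 a - linCurvSq H (p.1, p.2.1.1, p.2.1.2) a - chartPlaqCostOdd H p.1 p.2.1.1 p.2.1.2 a -
        ∑ i : Fin 4, ∑ j : Fin 4, ∑ k : Fin 4, ∑ l : Fin 4, Q i j k l *
          ((WithLp.ofLp (plaqVar H p.1 p.2.1.1 p.2.1.2 a i) ⬝ᵥ WithLp.ofLp (plaqVar H p.1 p.2.1.1 p.2.1.2 a j)) *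
            (WithLp.ofLp (plaqVar H p.1 p.2.1.1 p.2.1.2 a k) ⬝ᵥ WithLp.ofLp (plaqVar H p.1 p.2.1.1 p.2.1.2 a l)))) := by
    rw [quarticWilson, ← hPT, ← mul_sub, ← Finset.sum_sub_distrib]
  rw [hdiff, abs_mul]
  have hsum : |∑ p ∈ PT, (chartPlaqCost H p.1 p.2.1.1 p.2.1.2 a - linCurvSq H (p.1, p.2.1.1, p.2.1.2) a - chartPlaqCostOdd H p.1 p.2.1.1 p.2.1.2 a -
        ∑ i : Fin 4, ∑ j : Fin 4, ∑ k : Fin 4, ∑ l : Fin 4, Q i j k l *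
          ((WithLp.ofLp (plaqVar H p.1 p.2.1.1 p.2.1.2 a i) ⬝ᵥ WithLp.ofLp (plaqVar H p.1 p.2.1.1 p.2.1.2 a j)) *
            (WithLp.ofLp (plaqVar H p.1 p.2.1.1 p.2.1.2 a k) ⬝ᵥ WithLp.ofLp (plaqVar H p.1 p.2.1.1 p.2.1.2 a l))))| ≤ PT.card * (20 * s ^ 6) := by
    refine (Finset.abs_sum_le_sum_abs _ _).trans ?_
    refine (Finset.sum_le_sum hterm).trans (le_of_eq ?_)
    rw [Finset.sum_const, nsmul_eq_mul]
  have hcard := TiltSup.card_plaquettesTouching_le' hH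
  have hs6 : 0 ≤ 20 * s ^ 6 := by positivity
  calc |β| * _ ≤ |β| * (PT.card * (20 * s ^ 6)) := mul_le_mul_of_nonneg_left hsum (abs_nonneg _)
    _ ≤ |β| * (4096 * (H : ℝ) ^ 4 * (20 * s ^ 6)) := by rw [hPT]; gcongr
    _ = 81920 * |β| * (H : ℝ) ^ 4 * s ^ 6 := by ring

end WilsonTaylor

end Summit.QuantumFields.YangMills.Theorems.AllWindowsColdBoxBoxHighLine

end
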